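import Literature.ModelTheory.FiniteModelTheory.CohomologicalConsistency
import Mathlib.Data.Finset.Image
import Mathlib.Data.Fintype.Basic
import HarnessLib

/-!
# Cohomological `k`-consistency is transitive (Ó Conghaile 2022, Proposition 6)

Source: A. Ó Conghaile, *Cohomology in Constraint Satisfaction and Structure Isomorphism*,
MFCS 2022, LIPIcs 241, 75:1–75:16 = arXiv:2206.15253 (numbering of the arXiv version):
Proposition 6 (§4.3.1) and its proof in the Appendix ("Proofs omitted from Section 4: Proof of
Proposition (prop:comp)"), which rests on Observation 22 (same appendix).

## The mathematics (the printed proof, followed verbatim)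

Given non-empty families `S^{AB} ⊆ Hom_k(A,B)` and `S^{BC} ⊆ Hom_k(B,C)` in which every member is
`ℤ`-extendable (Observation 22), put `S^{AC} := {s ∘ t | t ∈ S^{AB}, s ∈ S^{BC} over t(dom t)}`.
For `p₀ = s₀ ∘ t₀` with `ℤ`-linear global sections `r^{t₀} = (∑_t z_t t)` of `S^{AB}` and
`r^{s₀} = (∑_s w_s s)` of `S^{BC}`, the family
`r^{p₀}_𝐚 := ∑_{t ∈ S^{AB}_𝐚} ∑_{s ∈ S^{BC}_{t(𝐚)}} z_t w_s (s ∘ t)`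
is a `ℤ`-linear global section of `S^{AC}` with `r^{p₀}_{𝐚₀} = p₀`: compatibility on `𝐚'' ⊆ 𝐚`
follows by pushing the compatibility of `r^{t₀}` (along `𝐚'' ⊆ 𝐚`) and of `r^{s₀}` (along
`t(𝐚'') ⊆ t(𝐚)`) through the bilinear re-indexing.  By Observation 22 (forth and downward closure
are subsumed by `ℤ`-extendability) this gives `A →^ℤ_k C`.

## Lean rendering

Sections over `U : Finset A` are functions `↥U → B` (file `CohomologicalConsistency`); the image
context `t(U)` is `SectionSystem.imageCtx t := univ.image t : Finset B`, composition is
`SectionSystem.compSec t s`, the composite family is `SectionSystem.compSys S T` and the composite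
`ℤ`-linear section is `SectionSystem.compZ rt rs` (a double `Finsupp.sum`).  The two "observations"
of the printed compatibility computation are the two applications of `Finsupp.sum_mapDomain_index`
in `SectionSystem.compZ_compat`.  Main result: `CohomologicallyKConsistent.trans` (and the graph
form `GraphCohomologicallyKConsistent.trans`).
-/

namespace Literature.ModelTheory.FiniteModelTheory

open FirstOrder FirstOrder.Language FirstOrder.Language.Structure

universe u v w

namespace SectionSystem

variable {A : Type u} {B : Type v} {C : Type w} [DecidableEq B]

/-- The IMAGE CONTEXT `t(U) ⊆ B` of a section `t` over `U`.
[cite: OConghaile2022, Appendix, proof of Prop. 6] -/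
def imageCtx {U : Finset A} (t : ↥U → B) : Finset B :=
  Finset.univ.image t

/-- Values of a section lie in its image context. [folklore] -/
theorem mem_imageCtx {U : Finset A} (t : ↥U → B) (x : ↥U) : t x ∈ imageCtx t :=
  Finset.mem_image_of_mem t (Finset.mem_univ x)

/-- `|t(U)| ≤ |U|`. [folklore] -/
theorem card_imageCtx_le {U : Finset A} (t : ↥U → B) : (imageCtx t).card ≤ U.card := by
  simpa [imageCtx] using (Finset.card_image_le (s := (Finset.univ : Finset ↥U)) (f := t))

/-- The image context of a restriction is contained in the image context.  [folklore] -/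
theorem imageCtx_restrict_subset {D U : Finset A} (h : D ⊆ U) (t : ↥U → B) :
    imageCtx (SectionSystem.restrict h t) ⊆ imageCtx t := by
  intro b hb
  obtain ⟨x, -, rfl⟩ := Finset.mem_image.1 hb
  exact mem_imageCtx t ⟨x, h x.2⟩

/-- COMPOSITION `s ∘ t` of a section `t` over `U ⊆ A` with a section `s` over its image context
`t(U) ⊆ B`. [cite: OConghaile2022, Appendix, proof of Prop. 6] -/
def compSec {U : Finset A} (t : ↥U → B) (s : ↥(imageCtx t) → C) : ↥U → C :=
  fun x => s ⟨t x, mem_imageCtx t x⟩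

/-- Unfolding `compSec`. [folklore] -/
@[simp] theorem compSec_apply {U : Finset A} (t : ↥U → B) (s : ↥(imageCtx t) → C) (x : ↥U) :
    compSec t s x = s ⟨t x, mem_imageCtx t x⟩ := rfl

/-- Restriction of a composite is the composite of the restrictions:
`(s ∘ t)|_D = s|_{t(D)} ∘ t|_D`.
[cite: OConghaile2022, Appendix, proof of Prop. 6 ("Downward-closure")] -/
theorem restrict_compSec {D U : Finset A} (h : D ⊆ U) (t : ↥U → B) (s : ↥(imageCtx t) → C) :
    SectionSystem.restrict h (compSec t s) =
      compSec (SectionSystem.restrict h t)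
        (SectionSystem.restrict (imageCtx_restrict_subset h t) s) :=
  rfl

/-- The COMPOSITE FAMILY `S^{AC} := {s ∘ t | t ∈ S^{AB}(U), s ∈ S^{BC}(t(U))}`.
[cite: OConghaile2022, Appendix, proof of Prop. 6] -/
def compSys (S : SectionSystem A B) (T : SectionSystem B C) : SectionSystem A C :=
  fun U => {p | ∃ t ∈ S U, ∃ s ∈ T (imageCtx t), compSec t s = p}

/-- The COMPOSITE `ℤ`-LINEAR SECTION
`r^{p₀}_U := ∑_{t} ∑_{s} z_t · w_s · (s ∘ t)` built from `r^{t₀} = (z_t)` and `r^{s₀} = (w_s)`.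
[cite: OConghaile2022, Appendix, proof of Prop. 6 ("ℤ-extendability property")] -/
noncomputable def compZ (rt : ZSections A B) (rs : ZSections B C) : ZSections A C :=
  fun U => (rt U).sum fun t z =>
    (rs (imageCtx t)).sum fun s w => Finsupp.single (compSec t s) (z * w)

omit [DecidableEq B] in
/-- Auxiliary: `Finsupp.mapDomain` commutes with `Finsupp.sum` (Mathlib's `Finsupp.mapDomain_sum`
with the domain of the summands decoupled from the domain of the coefficients). [folklore] -/
private theorem mapDomain_finsuppSum {X : Type*} {Y : Type*} {Y' : Type*} (g : Y → Y')
    (f : X →₀ ℤ) (v : X → ℤ → (Y →₀ ℤ)) :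
    Finsupp.mapDomain g (f.sum v) = f.sum fun x z => Finsupp.mapDomain g (v x z) := by
  simpa only [Finsupp.mapDomain.addMonoidHom_apply] using
    map_finsuppSum (Finsupp.mapDomain.addMonoidHom g) f v

omit [DecidableEq B] in
/-- Auxiliary: a `Finsupp.sum` of singles with coefficients `z * w` is additive in `z`.
[folklore] -/
private theorem sum_single_mul_add {ι : Type*} {X : Type*} (f : ι →₀ ℤ) (g : ι → X) (z₁ z₂ : ℤ) :
    (f.sum fun s w => Finsupp.single (g s) ((z₁ + z₂) * w)) =
      (f.sum fun s w => Finsupp.single (g s) (z₁ * w)) +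
        f.sum fun s w => Finsupp.single (g s) (z₂ * w) := by
  simp only [add_mul, Finsupp.single_add]
  exact Finsupp.sum_add

omit [DecidableEq B] in
/-- Auxiliary: the same sum with `z = 0` vanishes. [folklore] -/
private theorem sum_single_zero_mul {ι : Type*} {X : Type*} (f : ι →₀ ℤ) (g : ι → X) :
    (f.sum fun s w => Finsupp.single (g s) ((0 : ℤ) * w)) = 0 := by
  simp

variable {k : ℕ} {S : SectionSystem A B} {T : SectionSystem B C}

/-- SUPPORT: the composite `ℤ`-linear section is supported on the composite family.
[cite: OConghaile2022, Appendix, proof of Prop. 6] -/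
theorem compZ_support {rt : ZSections A B} {rs : ZSections B C}
    (hrt : ∀ (U : Finset A) (t : ↥U → B), rt U t ≠ 0 → t ∈ S U)
    (hrs : ∀ (W : Finset B) (s : ↥W → C), rs W s ≠ 0 → s ∈ T W)
    (U : Finset A) (p : ↥U → C) (hp : compZ rt rs U p ≠ 0) : p ∈ compSys S T U := by
  classical
  have hp' : p ∈ (compZ rt rs U).support := Finsupp.mem_support_iff.2 hp
  unfold compZ at hp'
  obtain ⟨t, ht, hp''⟩ := Finset.mem_biUnion.1 (Finsupp.support_sum hp')
  obtain ⟨s, hs, hp'''⟩ := Finset.mem_biUnion.1 (Finsupp.support_sum hp'')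
  have hps : p = compSec t s := Finset.mem_singleton.1 (Finsupp.support_single_subset hp''')
  exact ⟨t, hrt U t (Finsupp.mem_support_iff.1 ht), s, hrs _ s (Finsupp.mem_support_iff.1 hs),
    hps.symm⟩

/-- VALUE AT THE BASE CONTEXT: if `r^{t₀}_{U₀} = 1·t₀` and `r^{s₀}_{t₀(U₀)} = 1·s₀` then
`r^{p₀}_{U₀} = 1·(s₀ ∘ t₀)`. [cite: OConghaile2022, Appendix, proof of Prop. 6] -/
theorem compZ_base {rt : ZSections A B} {rs : ZSections B C} {U₀ : Finset A} {t₀ : ↥U₀ → B}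
    {s₀ : ↥(imageCtx t₀) → C} (ht₀ : rt U₀ = Finsupp.single t₀ 1)
    (hs₀ : rs (imageCtx t₀) = Finsupp.single s₀ 1) :
    compZ rt rs U₀ = Finsupp.single (compSec t₀ s₀) 1 := by
  unfold compZ
  rw [ht₀, Finsupp.sum_single_index (sum_single_zero_mul _ _), hs₀,
    Finsupp.sum_single_index (by simp)]
  simp

/-- COMPATIBILITY: the composite of two `ℤ`-linear global sections over the covers `A^{≤k}`,
`B^{≤k}` is compatible with restriction along every `D ⊆ U`, `|U| ≤ k` — the computation
`(r^{p₀}_𝐚)|_{𝐚''} = ∑_{t'', s''} z_{t''} w_{s''} (s'' ∘ t'')` of the source.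
[cite: OConghaile2022, Appendix, proof of Prop. 6 ("ℤ-extendability property")] -/
theorem compZ_compat {rt : ZSections A B} {rs : ZSections B C}
    (hrt : ∀ ⦃D U : Finset A⦄ (h : D ⊆ U), U.card ≤ k →
      Finsupp.mapDomain (SectionSystem.restrict h) (rt U) = rt D)
    (hrs : ∀ ⦃E W : Finset B⦄ (h : E ⊆ W), W.card ≤ k →
      Finsupp.mapDomain (SectionSystem.restrict h) (rs W) = rs E)
    ⦃D U : Finset A⦄ (h : D ⊆ U) (hU : U.card ≤ k) :
    Finsupp.mapDomain (SectionSystem.restrict h) (compZ rt rs U) = compZ rt rs D := by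
  classical
  unfold compZ
  -- push the restriction inside the double sum (left-hand side)
  simp only [mapDomain_finsuppSum, Finsupp.mapDomain_single, restrict_compSec]
  -- re-index the right-hand side along `rt D = (rt U)|_D` …
  rw [← hrt h hU, Finsupp.sum_mapDomain_index (fun t => sum_single_zero_mul _ _)
    (fun t z₁ z₂ => sum_single_mul_add _ _ z₁ z₂)]
  -- … and along `rs (t|_D (D)) = (rs (t(U)))|_{t(D)}` for every `t`
  refine Finsupp.sum_congr fun t _ => ?_
  rw [← hrs (imageCtx_restrict_subset h t) ((card_imageCtx_le t).trans hU),
    Finsupp.sum_mapDomain_index (fun s => by simp) (fun s w₁ w₂ => by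
      simp only [mul_add, Finsupp.single_add])]

/-- `ℤ`-EXTENDABILITY IN THE COMPOSITE FAMILY: if `t₀` is `ℤ`-extendable in `S` and `s₀` (over
`t₀(U₀)`) is `ℤ`-extendable in `T`, then `s₀ ∘ t₀` is `ℤ`-extendable in `S^{AC}`.
[cite: OConghaile2022, Appendix, proof of Prop. 6] -/
theorem ZExt.compSec {U₀ : Finset A} {t₀ : ↥U₀ → B} {s₀ : ↥(imageCtx t₀) → C}
    (ht : ZExt k S U₀ t₀) (hs : ZExt k T (imageCtx t₀) s₀) :
    ZExt k (compSys S T) U₀ (compSec t₀ s₀) := by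
  obtain ⟨rt, ⟨hrt₁, hrt₂⟩, hrt₀⟩ := ht
  obtain ⟨rs, ⟨hrs₁, hrs₂⟩, hrs₀⟩ := hs
  exact ⟨compZ rt rs, ⟨compZ_support hrt₁ hrs₁, compZ_compat hrt₂ hrs₂⟩, compZ_base hrt₀ hrs₀⟩

/-- The composite family of two non-empty downward-closed families is non-empty (it contains the
composite of the two empty sections). [cite: OConghaile2022, Appendix, proof of Prop. 6] -/
theorem compSys_nonempty (hS : S.Nonempty) (hSd : S.IsDownwardClosed) (hT : T.Nonempty)
    (hTd : T.IsDownwardClosed) : (compSys S T).Nonempty := by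
  obtain ⟨U, t, ht⟩ := hS
  obtain ⟨W, s, hs⟩ := hT
  let t₀ : ↥(∅ : Finset A) → B := SectionSystem.restrict (Finset.empty_subset U) t
  have himg : imageCtx t₀ ⊆ W := by
    intro b hb
    obtain ⟨x, -, -⟩ := Finset.mem_image.1 hb
    exact absurd x.2 (Finset.notMem_empty _)
  exact ⟨∅, compSec t₀ (SectionSystem.restrict himg s), t₀, hSd _ ht, _, hTd himg hs, rfl⟩

end SectionSystem

/-! ### Proposition 6 -/

section Structures

variable {L : Language} {k : ℕ} {A : Type u} {B : Type v} {C : Type w}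
  [L.Structure A] [L.Structure B] [L.Structure C] [DecidableEq B]

/-- Composites of partial homomorphisms are partial homomorphisms.
[cite: OConghaile2022, Appendix, proof of Prop. 6] -/
theorem IsPartialHom.compSec {U : Finset A} {t : ↥U → B} {s : ↥(SectionSystem.imageCtx t) → C}
    (ht : IsPartialHom L t) (hs : IsPartialHom L s) : IsPartialHom L (SectionSystem.compSec t s) :=
  fun _ r x hx => hs r (fun i => ⟨t (x i), SectionSystem.mem_imageCtx t (x i)⟩) (ht r x hx)

/-- The composite family of subfamilies of `𝓗_k(A,B)` and `𝓗_k(B,C)` lies in `𝓗_k(A,C)`.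
[cite: OConghaile2022, Appendix, proof of Prop. 6] -/
theorem compSys_le_homSystem {S : SectionSystem A B} {T : SectionSystem B C}
    (hS : S ≤ homSystem L k A B) (hT : T ≤ homSystem L k B C) :
    SectionSystem.compSys S T ≤ homSystem L k A C := by
  rintro U p ⟨t, ht, s, hs, rfl⟩
  exact ⟨(hS _ ht).1, (hS _ ht).2.compSec (hT _ hs).2⟩

/-- PROPOSITION 6 (TRANSITIVITY of cohomological `k`-consistency): for structures `A, B, C` over a
common signature, `A →^ℤ_k B` and `B →^ℤ_k C` imply `A →^ℤ_k C`.  (The source states it for finite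
structures over a finite relational signature; neither finiteness is used.)
[cite: OConghaile2022, Prop. 6] -/
theorem CohomologicallyKConsistent.trans [DecidableEq A]
    (hAB : CohomologicallyKConsistent L k A B) (hBC : CohomologicallyKConsistent L k B C) :
    CohomologicallyKConsistent L k A C := by
  obtain ⟨S, hS, hSne, hSd, hSself⟩ := (cohomologicallyKConsistent_iff L k A B).1 hAB
  obtain ⟨T, hT, hTne, hTd, hTself⟩ := (cohomologicallyKConsistent_iff L k B C).1 hBC
  refine (cohomologicallyKConsistent_iff_zext L k A C).2
    ⟨SectionSystem.compSys S T, compSys_le_homSystem hS hT,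
      SectionSystem.compSys_nonempty hSne hSd hTne hTd, ?_⟩
  rintro U p ⟨t, ht, s, hs, rfl⟩
  exact (hSself ht).2.compSec (hTself hs).2

end Structures

/-! ### Graph form -/

section Graph

variable {V : Type u} {W : Type v} {X : Type w} [DecidableEq V] [DecidableEq W]

/-- Transitivity of cohomological `k`-consistency for simple graphs:
`G →^ℤ_k H →^ℤ_k K ⟹ G →^ℤ_k K`. [cite: OConghaile2022, Prop. 6] -/
theorem GraphCohomologicallyKConsistent.trans {k : ℕ} {G : SimpleGraph V} {H : SimpleGraph W}
    {K : SimpleGraph X} (hGH : GraphCohomologicallyKConsistent k G H)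
    (hHK : GraphCohomologicallyKConsistent k H K) : GraphCohomologicallyKConsistent k G K := by
  rw [graphCohomologicallyKConsistent_iff] at hGH hHK ⊢
  exact @CohomologicallyKConsistent.trans Language.graph k V W X G.structure H.structure
    K.structure _ _ hGH hHK

end Graph

end Literature.ModelTheory.FiniteModelTheory
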